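import Summits.CriticalPhenomena.PercolationContinuityZ3.Theorems.PercNearOneGluingNoHeavyLowerTailQ44WeightedCount
import Summits.CriticalPhenomena.PercolationContinuityZ3.Theorems.PercNearOneGluingNoHeavyLowerTailStaircaseKleitman

/-!
# Kernel peeling: a GF(2) certificate for lower bounds on the number of goods, and `Q44` for all `n`

Support file for crux `stmt-CriticalPhenomena-4575` (master-family programme, quadratic four-point row `Q44`), seat
`prim-bnk-1` gen 26; memo `run/shared/lean/prim/prim-l12/FROM-prim-bnk-1-gen26-KERNEL-PEELING.md`.

`…Q44WeightedCount` reduced `Q44` (all `n`, all weights) to Conjecture W: for every monotone cell map `ι` on the subsets of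
a finite type, `#B1-sides + #dart-sides ≤ 2·#𝔊` where `𝔊 = {T : ι T ∈ AC, ι Tᶜ = ⊥}` is the (up-closed) family of GOODS.
Gens 22–25 attacked the stronger exact click-union count by Marica–Schönheim slicing.  Gen 26 observes that only an
UP-SET lower bound is needed and returns to the GF(2) method of `…StaircaseKleitman` / `…NineType*`, in the following
general form.

**Kernel Lemma (`KernelPeeling.exists_odd_good`).**  Let `𝔊` be an up-set of subsets of a finite type and `𝒮` a family of
subsets.  If some `M ∈ 𝒮` has a KERNEL `K ⊆ M` such that no other member of `𝒮` contains `K` and `S ∪ Kᶜ ∈ 𝔊` for every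
`S ∈ 𝒮` (i.e. `K \ S` is a co-good), then some `T ∈ 𝔊` contains an ODD number of members of `𝒮`.  (Parity, as in `…StaircaseKleitman`: summing
`#{S ∈ 𝒮 : S ∩ K ⊆ R}` over `R ⊆ K` gives `∑_S 2^{#K − #(S ∩ K)} ≡ 1`, `exists_odd_trace_of_kernel`; the odd fibre
`T = Kᶜ ∪ R` contains a member `S₀`, hence `T ⊇ S₀ ∪ Kᶜ ∈ 𝔊`.)

**Peeling theorem (`KernelPeeling.card_le_card_of_peeling`).**  If a family `ℛ` carries an injective rank `ord` and kernels
`ker M ⊆ M` such that for `ord M < ord M'`: `ker M ⊄ M'`, and for `ord M ≤ ord M'`: `M' ∪ (ker M)ᶜ ∈ 𝔊`, then every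
nonempty subfamily of `ℛ` has an odd target in `𝔊`; hence the parity signature `𝒮 ↦ {T ∈ 𝔊 : #{S ∈ 𝒮 : S ⊆ T} odd}`
is injective on the subfamilies of `ℛ` (the rows `([M ⊆ T])_{T ∈ 𝔊}`, `M ∈ ℛ`, are GF(2)-independent) and `#ℛ ≤ #𝔊`.
With `ker M = M` this is the classical "maximal element" argument (then `M` must be `⊆`-maximal among later members);
kernels make it strictly stronger (memo §3: the star `K_{1,4}` with doubled edges).

**Application (`TwoCopyMono.goodKernel_kerQ44_of_kernelPeelable`).**  If every monotone cell map admits a kernel-peelable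
family of subsets (w.r.t. its goods) of size at least half the weighted member count, then `GoodKernel kerQ44`, hence
`Q44 ≥ 0` on every finite weighted graph (`q44_cells_of_kernelPeelable`).  The hypothesis `KernelPeelable` is the open
selection statement of the memo (verified: all 70.8 M monotone maps of `B_4` — there even with `ker = id` —, and every
graph fibre with ≤ 8 edges where the search terminated; the GF(2) rank of ALL sides itself is ≥ ⌈w/2⌉ on all of `B_4`,
on the unit-step maps of `B_5`, and on 10⁴ random graph fibres with ≤ 12 edges).  No sorries, standard axioms.
-/

namespace Summit.CriticalPhenomena.PercolationContinuityZ3.Theorems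

namespace KernelPeeling

open Finset

variable {α : Type*} [DecidableEq α]

/-- **Odd trace through a kernel.**  If `M ∈ 𝒮`, `K ⊆ M`, and `M` is the only member of `𝒮` containing `K`, then for some
`R ⊆ K` the number of members `S ∈ 𝒮` with `S ∩ K ⊆ R` is odd.  (Double count
`∑_{R ⊆ K} #{S : S ∩ K ⊆ R} = ∑_{S ∈ 𝒮} 2 ^ (#K - #(S ∩ K))`; only the term `S = M` is odd.) [this work] -/
theorem exists_odd_trace_of_kernel (𝒮 : Finset (Finset α)) (M K : Finset α) (hM : M ∈ 𝒮) (hKM : K ⊆ M)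
    (huniq : ∀ S ∈ 𝒮, K ⊆ S → S = M) :
    ∃ R ∈ K.powerset, Odd #(𝒮.filter (fun S => S ∩ K ⊆ R)) := by
  by_contra hcon
  simp only [not_exists, not_and] at hcon
  have heven : ∀ R ∈ K.powerset, Even #(𝒮.filter (fun S => S ∩ K ⊆ R)) := by
    intro R hR
    exact Nat.not_odd_iff_even.1 (hcon R hR)
  have hdc : ∑ R ∈ K.powerset, #(𝒮.filter (fun S => S ∩ K ⊆ R))
      = ∑ S ∈ 𝒮, #(K.powerset.filter (fun R => S ∩ K ⊆ R)) := by
    simp_rw [Finset.card_filter]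
    exact Finset.sum_comm
  have hpow : ∑ S ∈ 𝒮, #(K.powerset.filter (fun R => S ∩ K ⊆ R))
      = ∑ S ∈ 𝒮, 2 ^ (#K - #(S ∩ K)) := by
    refine Finset.sum_congr rfl ?_
    intro S _
    exact StaircaseKleitman.card_filter_powerset_superset (S ∩ K) K Finset.inter_subset_right
  have hodd : Odd (∑ S ∈ 𝒮, 2 ^ (#K - #(S ∩ K))) := by
    rw [← Finset.add_sum_erase 𝒮 _ hM]
    have hMK : M ∩ K = K := Finset.inter_eq_right.2 hKM
    have h1 : 2 ^ (#K - #(M ∩ K)) = 1 := by rw [hMK]; simp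
    rw [h1]
    refine Odd.add_even odd_one ?_
    refine Finset.even_sum _ ?_
    intro S hS
    have hSne : S ≠ M := Finset.ne_of_mem_erase hS
    have hS𝒮 : S ∈ 𝒮 := Finset.mem_of_mem_erase hS
    have hlt : #(S ∩ K) < #K := by
      refine Finset.card_lt_card ?_
      refine lt_of_le_of_ne Finset.inter_subset_right ?_
      intro hEq
      have hKS : K ⊆ S := by
        have : S ∩ K = K := hEq
        rw [← this]
        exact Finset.inter_subset_left
      exact hSne (huniq S hS𝒮 hKS)
    have hne : #K - #(S ∩ K) ≠ 0 := by omega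
    exact (Nat.even_pow' hne).2 (by decide)
  have hevenSum : Even (∑ R ∈ K.powerset, #(𝒮.filter (fun S => S ∩ K ⊆ R))) :=
    Finset.even_sum _ heven
  rw [hdc, hpow] at hevenSum
  exact (Nat.not_even_iff_odd.2 hodd) hevenSum

variable [Fintype α]

/-- **Kernel Lemma.**  `𝔊` an up-set; if `M ∈ 𝒮` has a kernel `K ⊆ M` contained in no other member of `𝒮`, and `S ∪ Kᶜ ∈ 𝔊`
for every `S ∈ 𝒮`, then some `T ∈ 𝔊` contains an odd number of members of `𝒮`. [this work] -/
theorem exists_odd_good (𝔊 : Finset (Finset α)) (hG : IsUpperSet (𝔊 : Set (Finset α)))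
    (𝒮 : Finset (Finset α)) (M K : Finset α) (hM : M ∈ 𝒮) (hKM : K ⊆ M)
    (huniq : ∀ S ∈ 𝒮, K ⊆ S → S = M) (hco : ∀ S ∈ 𝒮, S ∪ Kᶜ ∈ 𝔊) :
    ∃ T ∈ 𝔊, Odd #(𝒮.filter (fun S => S ⊆ T)) := by
  obtain ⟨R, _, hodd⟩ := exists_odd_trace_of_kernel 𝒮 M K hM hKM huniq
  refine ⟨Kᶜ ∪ R, ?_, ?_⟩
  · -- the odd fibre is nonempty: some `S₀ ∈ 𝒮` lies in `T = Kᶜ ∪ R`, and `T ⊇ S₀ ∪ Kᶜ ∈ 𝔊`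
    have hpos : 0 < #(𝒮.filter (fun S => S ∩ K ⊆ R)) := Nat.pos_of_ne_zero (fun h0 => by
      rw [h0] at hodd; exact (Nat.not_even_iff_odd.2 hodd) (by decide))
    obtain ⟨S₀, hS₀⟩ := Finset.card_pos.1 hpos
    rw [Finset.mem_filter] at hS₀
    have hsub : S₀ ∪ Kᶜ ⊆ Kᶜ ∪ R := by
      intro x hx
      rcases Finset.mem_union.1 hx with hxS | hxK
      · exact (StaircaseKleitman.subset_compl_union_iff S₀ K R).2 hS₀.2 hxS
      · exact Finset.mem_union_left _ hxK
    exact hG hsub (hco S₀ hS₀.1)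
  · have hEq : 𝒮.filter (fun S => S ⊆ Kᶜ ∪ R) = 𝒮.filter (fun S => S ∩ K ⊆ R) := by
      refine Finset.filter_congr ?_
      intro S _
      exact StaircaseKleitman.subset_compl_union_iff S K R
    rw [hEq]; exact hodd

/-- **Kernel-peeling data** for a family `ℛ` with respect to an up-set `𝔊`: an injective rank `ord` and kernels `ker M ⊆ M`
such that an earlier kernel is never contained in a later member (`private_`) and `M' ∪ (ker M)ᶜ ∈ 𝔊` whenever
`ord M ≤ ord M'` (`cogood`; for `M' = M` this asks `univ ∈ 𝔊`). [this work] -/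
structure Peeling (𝔊 ℛ : Finset (Finset α)) where
  /-- the peeling rank (smaller = peeled first) -/
  ord : Finset α → ℕ
  /-- the kernel of a member -/
  ker : Finset α → Finset α
  /-- the rank is injective on `ℛ` -/
  ord_inj : ∀ M ∈ ℛ, ∀ M' ∈ ℛ, ord M = ord M' → M = M'
  /-- kernels are subsets -/
  ker_subset : ∀ M ∈ ℛ, ker M ⊆ M
  /-- an earlier kernel is private: no later member contains it -/
  private_ : ∀ M ∈ ℛ, ∀ M' ∈ ℛ, ord M < ord M' → ¬ ker M ⊆ M'
  /-- kernel differences towards later members are co-goods -/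
  cogood : ∀ M ∈ ℛ, ∀ M' ∈ ℛ, ord M ≤ ord M' → M' ∪ (ker M)ᶜ ∈ 𝔊

/-- Every nonempty subfamily of a kernel-peelable family has an odd target in `𝔊`. [this work] -/
theorem exists_odd_good_of_peeling {𝔊 ℛ : Finset (Finset α)} (hG : IsUpperSet (𝔊 : Set (Finset α)))
    (π : Peeling 𝔊 ℛ) (𝒮 : Finset (Finset α)) (h𝒮 : 𝒮 ⊆ ℛ) (hne : 𝒮.Nonempty) :
    ∃ T ∈ 𝔊, Odd #(𝒮.filter (fun S => S ⊆ T)) := by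
  obtain ⟨M, hM, hmin⟩ := Finset.exists_min_image 𝒮 π.ord hne
  refine exists_odd_good 𝔊 hG 𝒮 M (π.ker M) hM (π.ker_subset M (h𝒮 hM)) ?_ ?_
  · intro S hS hKS
    by_contra hne'
    have hle : π.ord M ≤ π.ord S := hmin S hS
    have hlt : π.ord M < π.ord S :=
      lt_of_le_of_ne hle (fun h => hne' (π.ord_inj S (h𝒮 hS) M (h𝒮 hM) h.symm))
    exact π.private_ M (h𝒮 hM) S (h𝒮 hS) hlt hKS
  · intro S hS
    exact π.cogood M (h𝒮 hM) S (h𝒮 hS) (hmin S hS)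

/-- The parity signature `𝒮 ↦ {T ∈ 𝔊 : #{S ∈ 𝒮 : S ⊆ T} odd}` is injective on the subfamilies of a kernel-peelable
family (i.e. the inclusion rows of `ℛ` against `𝔊` are linearly independent over GF(2)). [this work] -/
theorem parityMap_injOn {𝔊 ℛ : Finset (Finset α)} (hG : IsUpperSet (𝔊 : Set (Finset α))) (π : Peeling 𝔊 ℛ) :
    Set.InjOn (fun 𝒮 : Finset (Finset α) => 𝔊.filter (fun T => Odd #(𝒮.filter (fun S => S ⊆ T))))
      (ℛ.powerset : Set (Finset (Finset α))) := by
  intro 𝒮₁ h₁ 𝒮₂ h₂ heq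
  have h₁' : 𝒮₁ ⊆ ℛ := Finset.mem_powerset.1 (Finset.mem_coe.1 h₁)
  have h₂' : 𝒮₂ ⊆ ℛ := Finset.mem_powerset.1 (Finset.mem_coe.1 h₂)
  by_contra hne
  set 𝒟 : Finset (Finset α) := (𝒮₁ \ 𝒮₂) ∪ (𝒮₂ \ 𝒮₁) with h𝒟
  have h𝒟ℛ : 𝒟 ⊆ ℛ := by
    intro S hS
    rcases Finset.mem_union.1 hS with h | h
    · exact h₁' (Finset.mem_sdiff.1 h).1
    · exact h₂' (Finset.mem_sdiff.1 h).1
  have h𝒟ne : 𝒟.Nonempty := by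
    rw [Finset.nonempty_iff_ne_empty]
    intro hemp
    apply hne
    have h12 : 𝒮₁ \ 𝒮₂ = ∅ :=
      Finset.subset_empty.1 (by rw [← hemp]; exact Finset.subset_union_left)
    have h21 : 𝒮₂ \ 𝒮₁ = ∅ :=
      Finset.subset_empty.1 (by rw [← hemp]; exact Finset.subset_union_right)
    exact Finset.Subset.antisymm (Finset.sdiff_eq_empty_iff_subset.1 h12)
      (Finset.sdiff_eq_empty_iff_subset.1 h21)
  obtain ⟨T, hT𝔊, hodd⟩ := exists_odd_good_of_peeling hG π 𝒟 h𝒟ℛ h𝒟ne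
  have hsame : Odd #(𝒮₁.filter (fun S => S ⊆ T)) ↔ Odd #(𝒮₂.filter (fun S => S ⊆ T)) := by
    have hT := congrArg (fun F => T ∈ F) heq
    simp only [Finset.mem_filter, eq_iff_iff] at hT
    constructor
    · intro h; exact (hT.1 ⟨hT𝔊, h⟩).2
    · intro h; exact (hT.2 ⟨hT𝔊, h⟩).2
  set a := #((𝒮₁ \ 𝒮₂).filter (fun S => S ⊆ T)) with ha
  set b := #((𝒮₂ \ 𝒮₁).filter (fun S => S ⊆ T)) with hb
  set c := #((𝒮₁ ∩ 𝒮₂).filter (fun S => S ⊆ T)) with hc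
  have hdisj : Disjoint (𝒮₁ \ 𝒮₂) (𝒮₂ \ 𝒮₁) := by
    rw [Finset.disjoint_left]
    intro S hS hS'
    exact (Finset.mem_sdiff.1 hS).2 (Finset.mem_sdiff.1 hS').1
  have hcard𝒟 : #(𝒟.filter (fun S => S ⊆ T)) = a + b := by
    rw [h𝒟, Finset.filter_union]
    exact Finset.card_union_of_disjoint (Finset.disjoint_filter_filter hdisj)
  have hsplit₁ : #(𝒮₁.filter (fun S => S ⊆ T)) = a + c := by
    rw [ha, hc, ← Finset.card_union_of_disjoint
      (Finset.disjoint_filter_filter (Finset.disjoint_sdiff_inter 𝒮₁ 𝒮₂)),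
      ← Finset.filter_union, Finset.sdiff_union_inter]
  have hsplit₂ : #(𝒮₂.filter (fun S => S ⊆ T)) = b + c := by
    rw [hb, hc, Finset.inter_comm, ← Finset.card_union_of_disjoint
      (Finset.disjoint_filter_filter (Finset.disjoint_sdiff_inter 𝒮₂ 𝒮₁)),
      ← Finset.filter_union, Finset.sdiff_union_inter]
  have hiff : Even (a + c) ↔ Even (b + c) := by
    rw [← hsplit₁, ← hsplit₂, ← Nat.not_odd_iff_even, ← Nat.not_odd_iff_even]
    exact not_congr hsame
  have h2 : Even ((a + c) + (b + c)) := Nat.even_add.2 hiff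
  have h3 : (a + c) + (b + c) = (a + b) + 2 * c := by ring
  rw [h3, Nat.even_add] at h2
  have heven : Even (a + b) := h2.2 (even_two_mul c)
  rw [← hcard𝒟] at heven
  exact (Nat.not_even_iff_odd.2 hodd) heven

/-- **Peeling theorem.**  A kernel-peelable family w.r.t. an up-set `𝔊` has at most `#𝔊` members. [this work] -/
theorem card_le_card_of_peeling {𝔊 ℛ : Finset (Finset α)} (hG : IsUpperSet (𝔊 : Set (Finset α)))
    (π : Peeling 𝔊 ℛ) : #ℛ ≤ #𝔊 := by
  have hinj := parityMap_injOn hG π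
  have hmaps : Set.MapsTo (fun 𝒮 : Finset (Finset α) =>
        𝔊.filter (fun T => Odd #(𝒮.filter (fun S => S ⊆ T))))
      (ℛ.powerset : Set (Finset (Finset α))) (𝔊.powerset : Set (Finset (Finset α))) := by
    intro 𝒮 _
    exact Finset.mem_coe.2 (Finset.mem_powerset.2 (Finset.filter_subset _ _))
  have hle : #(ℛ.powerset) ≤ #(𝔊.powerset) := Finset.card_le_card_of_injOn _ hmaps hinj
  rw [Finset.card_powerset, Finset.card_powerset] at hle
  exact (Nat.pow_le_pow_iff_right (by norm_num : 1 < 2)).1 hle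

end KernelPeeling

/-! ## Application: `Q44` for all `n` from kernel-peelable families of sides -/

namespace TwoCopyMono

open Finset FourPointAtoms KernelPeeling

/-- The goods of a cell map: `{T : ι T ∈ AC, ι Tᶜ = ⊥}`. [this work] -/
def goods {γ : Type} [Fintype γ] [DecidableEq γ] (ι : Finset γ → Fin 15) : Finset (Finset γ) :=
  Finset.univ.filter fun T => isAC (ι T) ∧ ι Tᶜ = 0

/-- The goods of a monotone cell map form an up-set. [this work] -/
theorem goods_upper {γ : Type} [Fintype γ] [DecidableEq γ] (ι : Finset γ → Fin 15)
    (hmono : ∀ A B : Finset γ, A ⊆ B → ple (ι A) (ι B) = true) : IsUpperSet (goods ι : Set (Finset γ)) :=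
  cellMap_goods_upper ι hmono (goods ι) (fun T => by unfold goods; simp)

/-- **The selection hypothesis (Conjecture L_K of the memo)** for a weight-two point set `B` and a weight-one point set `D`:
every monotone cell map on the subsets of a finite type admits a family of subsets that is kernel-peelable with respect to
its goods and has at least half the weighted member count (`#B`-sides `+ #D`-sides) elements.  The case of interest is
`B = q44B1`, `D = q44Darts`. [this work] -/
structure KernelPeelable (B D : Finset (Fin 15 × Fin 15)) : Prop where
  /-- existence of a large kernel-peelable family for every monotone cell map -/
  exists_peeling : ∀ (γ : Type) [Fintype γ] [DecidableEq γ] (ι : Finset γ → Fin 15),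
    (∀ A B : Finset γ, A ⊆ B → ple (ι A) (ι B) = true) →
      ∃ ℛ : Finset (Finset γ), Nonempty (Peeling (goods ι) ℛ) ∧
        #(Finset.univ.filter fun T => (ι T, ι Tᶜ) ∈ B) + #(Finset.univ.filter fun T => (ι T, ι Tᶜ) ∈ D) ≤ 2 * #ℛ

/-- **Conjecture W from kernel peeling.** [this work] -/
theorem goodKernel_kerQ44_of_kernelPeelable (h : KernelPeelable q44B1 q44Darts) : GoodKernel kerQ44 := by
  rw [goodKernel_kerQ44_iff_weightedCount]
  intro γ _ _ ι hmono
  obtain ⟨ℛ, ⟨π⟩, hcount⟩ := h.exists_peeling γ ι hmono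
  have hℛ : #ℛ ≤ #(goods ι) := card_le_card_of_peeling (goods_upper ι hmono) π
  have hg : #(goods ι) = #(Finset.univ.filter fun T => isAC (ι T) ∧ ι Tᶜ = 0) := rfl
  rw [← hg]
  exact hcount.trans (Nat.mul_le_mul_left 2 hℛ)

/-- **`Q44` for all `n` from kernel peeling**: if `KernelPeelable` holds then on every finite weighted graph, for all
marked points, `2·B1 + D ≤ 2[P(ab|cy)+P(abcy)]·P(a|b|c|y)`. [this work] -/
theorem q44_cells_of_kernelPeelable (h : KernelPeelable q44B1 q44Darts) {n : ℕ} (w : Sym2 (Fin n) → unitInterval)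
    (a b c y : Fin n) :
    2 * (cell w a b c y 11 * cell w a b c y 9 + cell w a b c y 11 * cell w a b c y 8 + cell w a b c y 6 * cell w a b c y 8 +
        cell w a b c y 6 * cell w a b c y 1 + cell w a b c y 1 * cell w a b c y 8) +
      (cell w a b c y 2 * cell w a b c y 13 + cell w a b c y 1 * cell w a b c y 13 + cell w a b c y 5 * cell w a b c y 12 +
        cell w a b c y 1 * cell w a b c y 12 + cell w a b c y 6 * cell w a b c y 10 + cell w a b c y 6 * cell w a b c y 7 +
        cell w a b c y 2 * cell w a b c y 10 + cell w a b c y 5 * cell w a b c y 7) ≤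
      2 * ((cell w a b c y 11 + cell w a b c y 14) * cell w a b c y 0) :=
  q44_cells_of_goodKernel (goodKernel_kerQ44_of_kernelPeelable h) w a b c y

/-- Sanity: `ℛ = {univ}` with `ker = id` is a peeling for any family `𝔊` containing `univ` (the non-vacuity of `Peeling`).
[this work] -/
theorem peeling_singleton_univ {α : Type*} [DecidableEq α] [Fintype α] (𝔊 : Finset (Finset α))
    (huniv : (Finset.univ : Finset α) ∈ 𝔊) : Nonempty (Peeling 𝔊 {Finset.univ}) :=
  ⟨{ ord := fun _ => 0
     ker := fun M => M
     ord_inj := fun M hM M' hM' _ => by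
       rw [Finset.mem_singleton] at hM hM'; rw [hM, hM']
     ker_subset := fun M _ => subset_refl M
     private_ := fun M _ M' _ h => absurd h (lt_irrefl 0)
     cogood := fun M hM M' hM' _ => by
       rw [Finset.mem_singleton] at hM hM'
       rw [hM, hM', Finset.compl_univ, Finset.union_empty]; exact huniv }⟩

end TwoCopyMono

end Summit.CriticalPhenomena.PercolationContinuityZ3.Theorems

/-! ## Appendix (gen 26): the order-free certificate — odd targets for every subfamily, hereditarily kernel-good families

A kernel peeling is one UNIFORM way (a linear order) to give every nonempty subfamily an odd target.  The counting conclusion only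
needs the odd targets themselves (`card_le_card_of_oddTargets`), and the Kernel Lemma may be applied with a member/kernel chosen PER
SUBFAMILY (`HKGood`): strictly more flexible than a peeling (memo §4c: on the hardest sampled fibre random independent families of the
target size are hereditarily kernel-good while the order search stalls), and the natural format for a structural proof by case analysis. -/

namespace Summit.CriticalPhenomena.PercolationContinuityZ3.Theorems

namespace KernelPeeling

open Finset

variable {α : Type*} [DecidableEq α] [Fintype α]

omit [Fintype α] in
/-- If every nonempty subfamily of `ℛ` has an odd target in `𝔊`, the parity signature is injective on the subfamilies of `ℛ`
(the inclusion rows of `ℛ` against `𝔊` are GF(2)-independent). [this work] -/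
theorem parityMap_injOn_of_oddTargets {𝔊 ℛ : Finset (Finset α)}
    (hodd : ∀ 𝒮 ⊆ ℛ, 𝒮.Nonempty → ∃ T ∈ 𝔊, Odd #(𝒮.filter (fun S => S ⊆ T))) :
    Set.InjOn (fun 𝒮 : Finset (Finset α) => 𝔊.filter (fun T => Odd #(𝒮.filter (fun S => S ⊆ T))))
      (ℛ.powerset : Set (Finset (Finset α))) := by
  intro 𝒮₁ h₁ 𝒮₂ h₂ heq
  have h₁' : 𝒮₁ ⊆ ℛ := Finset.mem_powerset.1 (Finset.mem_coe.1 h₁)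
  have h₂' : 𝒮₂ ⊆ ℛ := Finset.mem_powerset.1 (Finset.mem_coe.1 h₂)
  by_contra hne
  set 𝒟 : Finset (Finset α) := (𝒮₁ \ 𝒮₂) ∪ (𝒮₂ \ 𝒮₁) with h𝒟
  have h𝒟ℛ : 𝒟 ⊆ ℛ := by
    intro S hS
    rcases Finset.mem_union.1 hS with h | h
    · exact h₁' (Finset.mem_sdiff.1 h).1
    · exact h₂' (Finset.mem_sdiff.1 h).1
  have h𝒟ne : 𝒟.Nonempty := by
    rw [Finset.nonempty_iff_ne_empty]
    intro hemp
    apply hne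
    have h12 : 𝒮₁ \ 𝒮₂ = ∅ := Finset.subset_empty.1 (by rw [← hemp]; exact Finset.subset_union_left)
    have h21 : 𝒮₂ \ 𝒮₁ = ∅ := Finset.subset_empty.1 (by rw [← hemp]; exact Finset.subset_union_right)
    exact Finset.Subset.antisymm (Finset.sdiff_eq_empty_iff_subset.1 h12) (Finset.sdiff_eq_empty_iff_subset.1 h21)
  obtain ⟨T, hT𝔊, hoddT⟩ := hodd 𝒟 h𝒟ℛ h𝒟ne
  have hsame : Odd #(𝒮₁.filter (fun S => S ⊆ T)) ↔ Odd #(𝒮₂.filter (fun S => S ⊆ T)) := by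
    have hT := congrArg (fun F => T ∈ F) heq
    simp only [Finset.mem_filter, eq_iff_iff] at hT
    exact ⟨fun hh => (hT.1 ⟨hT𝔊, hh⟩).2, fun hh => (hT.2 ⟨hT𝔊, hh⟩).2⟩
  set a := #((𝒮₁ \ 𝒮₂).filter (fun S => S ⊆ T)) with ha
  set b := #((𝒮₂ \ 𝒮₁).filter (fun S => S ⊆ T)) with hb
  set c := #((𝒮₁ ∩ 𝒮₂).filter (fun S => S ⊆ T)) with hc
  have hdisj : Disjoint (𝒮₁ \ 𝒮₂) (𝒮₂ \ 𝒮₁) := by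
    rw [Finset.disjoint_left]
    intro S hS hS'
    exact (Finset.mem_sdiff.1 hS).2 (Finset.mem_sdiff.1 hS').1
  have hcard𝒟 : #(𝒟.filter (fun S => S ⊆ T)) = a + b := by
    rw [h𝒟, Finset.filter_union]
    exact Finset.card_union_of_disjoint (Finset.disjoint_filter_filter hdisj)
  have hsplit₁ : #(𝒮₁.filter (fun S => S ⊆ T)) = a + c := by
    rw [ha, hc, ← Finset.card_union_of_disjoint
      (Finset.disjoint_filter_filter (Finset.disjoint_sdiff_inter 𝒮₁ 𝒮₂)), ← Finset.filter_union, Finset.sdiff_union_inter]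
  have hsplit₂ : #(𝒮₂.filter (fun S => S ⊆ T)) = b + c := by
    rw [hb, hc, Finset.inter_comm, ← Finset.card_union_of_disjoint
      (Finset.disjoint_filter_filter (Finset.disjoint_sdiff_inter 𝒮₂ 𝒮₁)), ← Finset.filter_union, Finset.sdiff_union_inter]
  have hiff : Even (a + c) ↔ Even (b + c) := by
    rw [← hsplit₁, ← hsplit₂, ← Nat.not_odd_iff_even, ← Nat.not_odd_iff_even]
    exact not_congr hsame
  have h2 : Even ((a + c) + (b + c)) := Nat.even_add.2 hiff
  have h3 : (a + c) + (b + c) = (a + b) + 2 * c := by ring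
  rw [h3, Nat.even_add] at h2
  have heven : Even (a + b) := h2.2 (even_two_mul c)
  rw [← hcard𝒟] at heven
  exact (Nat.not_even_iff_odd.2 hoddT) heven

omit [Fintype α] in
/-- **Odd targets suffice**: if every nonempty subfamily of `ℛ` has an odd target in `𝔊` then `#ℛ ≤ #𝔊`. [this work] -/
theorem card_le_card_of_oddTargets {𝔊 ℛ : Finset (Finset α)}
    (hodd : ∀ 𝒮 ⊆ ℛ, 𝒮.Nonempty → ∃ T ∈ 𝔊, Odd #(𝒮.filter (fun S => S ⊆ T))) : #ℛ ≤ #𝔊 := by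
  have hmaps : Set.MapsTo (fun 𝒮 : Finset (Finset α) => 𝔊.filter (fun T => Odd #(𝒮.filter (fun S => S ⊆ T))))
      (ℛ.powerset : Set (Finset (Finset α))) (𝔊.powerset : Set (Finset (Finset α))) :=
    fun 𝒮 _ => Finset.mem_coe.2 (Finset.mem_powerset.2 (Finset.filter_subset _ _))
  have hle : #(ℛ.powerset) ≤ #(𝔊.powerset) := Finset.card_le_card_of_injOn _ hmaps (parityMap_injOn_of_oddTargets hodd)
  rw [Finset.card_powerset, Finset.card_powerset] at hle
  exact (Nat.pow_le_pow_iff_right (by norm_num : 1 < 2)).1 hle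

/-- A family `ℛ` is **hereditarily kernel-good** for `𝔊` if every nonempty subfamily `𝒮 ⊆ ℛ` has a member `M` with a kernel
`K ⊆ M` that no other member of `𝒮` contains and with `S ∪ Kᶜ ∈ 𝔊` for all `S ∈ 𝒮`. [this work] -/
def HKGood (𝔊 ℛ : Finset (Finset α)) : Prop :=
  ∀ 𝒮 ⊆ ℛ, 𝒮.Nonempty → ∃ M ∈ 𝒮, ∃ K ⊆ M, (∀ S ∈ 𝒮, K ⊆ S → S = M) ∧ (∀ S ∈ 𝒮, S ∪ Kᶜ ∈ 𝔊)

/-- A kernel peeling makes the family hereditarily kernel-good (take the `ord`-first member of the subfamily). [this work] -/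
theorem hkGood_of_peeling {𝔊 ℛ : Finset (Finset α)} (π : Peeling 𝔊 ℛ) : HKGood 𝔊 ℛ := by
  intro 𝒮 h𝒮 hne
  obtain ⟨M, hM, hmin⟩ := Finset.exists_min_image 𝒮 π.ord hne
  refine ⟨M, hM, π.ker M, π.ker_subset M (h𝒮 hM), ?_, fun S hS => π.cogood M (h𝒮 hM) S (h𝒮 hS) (hmin S hS)⟩
  intro S hS hKS
  by_contra hne'
  have hlt : π.ord M < π.ord S :=
    lt_of_le_of_ne (hmin S hS) (fun h => hne' (π.ord_inj S (h𝒮 hS) M (h𝒮 hM) h.symm))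
  exact π.private_ M (h𝒮 hM) S (h𝒮 hS) hlt hKS

/-- **Order-free peeling theorem**: a hereditarily kernel-good family w.r.t. an up-set `𝔊` has at most `#𝔊` members. [this work] -/
theorem card_le_card_of_hkGood {𝔊 ℛ : Finset (Finset α)} (hG : IsUpperSet (𝔊 : Set (Finset α))) (h : HKGood 𝔊 ℛ) :
    #ℛ ≤ #𝔊 :=
  card_le_card_of_oddTargets fun 𝒮 h𝒮 hne => by
    obtain ⟨M, hM, K, hKM, huniq, hco⟩ := h 𝒮 h𝒮 hne
    exact exists_odd_good 𝔊 hG 𝒮 M K hM hKM huniq hco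

end KernelPeeling

end Summit.CriticalPhenomena.PercolationContinuityZ3.Theorems
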